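import Summits.AtomisticToContinuum.Crystallization.Theorems.FrustratedLawDichotomyTwoShellRigidityGaugeFix

/-!
# FrustratedLawDichotomy · two-shell rigidity — `GaugeFix` PROVED for the least-squares gauge (PART B: both kissing patterns, consequences)

PART A (`…TwoShellRigidityGaugeFix`) proves `gaugeFix_lsGauge_of_frame : Pat.card = 12 → (∀ z, Σ_u ⟪u, z⟫ u = 4 z) → GaugeFix Pat (lsGauge Pat) (2√3)`.
Here:

* `frame_fcc`, `frame_hcp` — the two kissing patterns are TIGHT FRAMES `Σ_u ⟪u, z⟫ u = 4 z` (integer second moments `Σ v_j v_k = 8 δ_jk` of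
  `fccInt` / `72 δ_jk` of `hcpInt`, by `decide`, transported through the scaling `S/√N`);
* ★ `gaugeFix_fcc`, `gaugeFix_hcp` — lens-5 g32's analytic entry hypothesis `GaugeFix` DISCHARGED at both patterns (`κ = 2√3`);
* `regaugeAt_lsGauge_fcc/hcp` — `RegaugeAt Pat probes26 (lsGauge Pat) θ P (…)` UNCONDITIONAL (crude constants, `ρ = 11281/10000` by name
  from hand-1's `coversProbes26`);
* ★★ `aperiodicFrustratedLawGap_of_gaugedLadders26_lsGauge` — the crux of item 27623 BY NAME from `Door ∧ Price(1/100) ∧ G ∧ P`, per pattern an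
  UNGAUGED 26-probe entry [CERT] and a `GLadderCert26At` chain [CERT · LP tables] starting at the re-gauged tuple, plus `1.1281·Q.1 < 1/20`:
  the two `RegaugeAt` hypotheses of `aperiodicFrustratedLawGap_of_gaugedLadders26` (…GaugedLadderD) are gone — what remains on the M column's
  entry side is CERT only.

DEF-FREE; 0 sorry.  Prover hand 1, gen 12 (decomp-a2c), --supports stmt-AtomisticToContinuum-27623.
-/

noncomputable section

namespace Summit.AtomisticToContinuum.Crystallization.Theorems.FrustratedLawDichotomyTwoShellRigidityGaugeFix

open Literature.Geometry.DiscreteGeometry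
open Summit.AtomisticToContinuum.Crystallization.Theorems.FrustratedLawDichotomyTwoShellRigidityCut
open Summit.AtomisticToContinuum.Crystallization.Theorems.FrustratedLawDichotomyTwoShellRigidityCells (PriceTol)
open Summit.AtomisticToContinuum.Crystallization.Theorems.FrustratedLawDichotomyTwoShellRigidityGaugedLadder
open scoped RealInnerProductSpace

/-! ## 1. The two kissing patterns are tight frames (second moments of the integer models) -/

/-- Second moments through the scaling `S/√N`: `Σ_u u_j u_k = N⁻¹ Σ_{v ∈ S} v_j v_k`. [folklore] -/
theorem sum_coord_mul_scaledPattern (S : Finset (Fin 3 → ℤ)) {N : ℕ} (hN : N ≠ 0) (j k : Fin 3) :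
    ∑ u : ↥(scaledPattern S N), (u : E3) j * (u : E3) k = (N : ℝ)⁻¹ * ∑ v ∈ S, ((v j : ℝ) * (v k : ℝ)) := by
  rw [Finset.sum_coe_sort (scaledPattern S N) (fun u : E3 => u j * u k)]
  unfold scaledPattern
  rw [Finset.sum_image fun v _ w _ h => scaledPattern_map_injective hN h, Finset.mul_sum]
  refine Finset.sum_congr rfl fun v _ => ?_
  have hsq : (Real.sqrt N)⁻¹ * (Real.sqrt N)⁻¹ = (N : ℝ)⁻¹ := by
    rw [← mul_inv, Real.mul_self_sqrt (Nat.cast_nonneg N)]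
  simp only [PiLp.smul_apply, intVec_apply, smul_eq_mul]
  rw [← hsq]
  ring

/-- Second moments of the fcc integer model: `Σ_{v ∈ fccInt} v_j v_k = 8 δ_jk`. [folklore; by `decide`] -/
theorem secondMoment_fccInt : ∀ j k : Fin 3, ∑ v ∈ fccInt, v j * v k = if j = k then (8 : ℤ) else 0 := by decide

/-- Second moments of the hcp integer model: `Σ_{v ∈ hcpInt} v_j v_k = 72 δ_jk`. [folklore; by `decide`] -/
theorem secondMoment_hcpInt : ∀ j k : Fin 3, ∑ v ∈ hcpInt, v j * v k = if j = k then (72 : ℤ) else 0 := by decide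

/-- `⟪u, z⟫` in coordinates. [folklore] -/
private theorem inner_coord (u z : E3) : ⟪u, z⟫ = u 0 * z 0 + u 1 * z 1 + u 2 * z 2 := by
  have h := inner_vec3 (u 0) (u 1) (u 2) z
  have hu : vec3 (u 0) (u 1) (u 2) = u := by
    ext i; fin_cases i <;> rfl
  rw [hu] at h
  exact h

/-- **Tight-frame identity** of a scaled pattern with integer second moments `4N · δ_jk`: `Σ_u ⟪u, z⟫ u = 4 z`. [folklore] -/
theorem frame_of_secondMoment {S : Finset (Fin 3 → ℤ)} {N : ℕ} (hN : N ≠ 0) {m : ℤ}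
    (hS : ∀ j k : Fin 3, ∑ v ∈ S, v j * v k = if j = k then m else 0) (hm : (m : ℝ) = 4 * N) (z : E3) :
    ∑ u : ↥(scaledPattern S N), ⟪(u : E3), z⟫ • (u : E3) = (4 : ℝ) • z := by
  have hN' : (N : ℝ) ≠ 0 := Nat.cast_ne_zero.2 hN
  have hjk : ∀ j k : Fin 3, ∑ u : ↥(scaledPattern S N), (u : E3) j * (u : E3) k = if j = k then (4 : ℝ) else 0 := by
    intro j k
    rw [sum_coord_mul_scaledPattern S hN j k]
    have hcast : ∑ v ∈ S, ((v j : ℝ) * (v k : ℝ)) = ((∑ v ∈ S, v j * v k : ℤ) : ℝ) := by push_cast; rfl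
    rw [hcast, hS j k]
    split_ifs
    · rw [hm]; field_simp
    · simp
  have hk : ∀ k : Fin 3, ∑ u : ↥(scaledPattern S N), ⟪(u : E3), z⟫ * (u : E3) k = 4 * z k := by
    intro k
    have hexp : ∀ u : ↥(scaledPattern S N), ⟪(u : E3), z⟫ * (u : E3) k =
        z 0 * ((u : E3) 0 * (u : E3) k) + z 1 * ((u : E3) 1 * (u : E3) k) + z 2 * ((u : E3) 2 * (u : E3) k) := by
      intro u; rw [inner_coord]; ring
    simp_rw [hexp, Finset.sum_add_distrib, ← Finset.mul_sum, hjk]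
    fin_cases k <;> simp [mul_comm]
  ext k
  simp only [WithLp.ofLp_sum, WithLp.ofLp_smul, Finset.sum_apply, Pi.smul_apply, smul_eq_mul]
  exact hk k

/-- **The FCC kissing pattern is a tight frame**: `Σ_u ⟪u, z⟫ u = 4 z`. [folklore] -/
theorem frame_fcc (z : E3) : ∑ u : ↥fccKissingPattern, ⟪(u : E3), z⟫ • (u : E3) = (4 : ℝ) • z :=
  frame_of_secondMoment (S := fccInt) (N := 2) two_ne_zero secondMoment_fccInt (by norm_num) z

/-- **The HCP kissing pattern is a tight frame**: `Σ_u ⟪u, z⟫ u = 4 z`. [folklore] -/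
theorem frame_hcp (z : E3) : ∑ u : ↥hcpKissingPattern, ⟪(u : E3), z⟫ • (u : E3) = (4 : ℝ) • z :=
  frame_of_secondMoment (S := hcpInt) (N := 18) (by norm_num) secondMoment_hcpInt (by norm_num) z

/-- ★ **`GaugeFix` at the FCC pattern, least-squares gauge, `κ = 2√3`** — lens-5 g32's analytic entry hypothesis DISCHARGED. -/
theorem gaugeFix_fcc : GaugeFix fccKissingPattern (lsGauge fccKissingPattern) (2 * Real.sqrt 3) :=
  gaugeFix_lsGauge_of_frame card_fccKissingPattern frame_fcc

/-- ★ **`GaugeFix` at the HCP pattern, least-squares gauge, `κ = 2√3`.** -/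
theorem gaugeFix_hcp : GaugeFix hcpKissingPattern (lsGauge hcpKissingPattern) (2 * Real.sqrt 3) :=
  gaugeFix_lsGauge_of_frame card_hcpKissingPattern frame_hcp

/-! ## 2. Consequences BY NAME: unconditional re-gauging, and the crux with the re-gauging hypotheses gone -/

/-- **`RegaugeAt` at fcc, UNCONDITIONAL** (26 probes, `ρ = 11281/10000`, ls gauge, crude constants with `κ = 2√3`): an ungauged
26-probe fit `P = (a, aq, b, bq)` becomes an ls-gauged one with tuple `((1+κ)ρa, ρ·aq + √2κρa, ρb + κρa, ρ·bq + κρa)`. -/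
theorem regaugeAt_lsGauge_fcc (θ : ℝ) (P : ℝ × ℝ × ℝ × ℝ) :
    RegaugeAt fccKissingPattern probes26 (lsGauge fccKissingPattern) θ P
      ((1 + 2 * Real.sqrt 3) * (11281 / 10000 * P.1),
        11281 / 10000 * P.2.1 + Real.sqrt 2 * (2 * Real.sqrt 3 * (11281 / 10000 * P.1)),
        11281 / 10000 * P.2.2.1 + 2 * Real.sqrt 3 * (11281 / 10000 * P.1),
        11281 / 10000 * P.2.2.2 + 2 * Real.sqrt 3 * (11281 / 10000 * P.1)) :=
  regaugeAt_of_gaugeFix (fun _ hz => norm_eq_one_of_mem_fccKissingPattern hz) norm_le_one_of_mem_probes26 (by norm_num)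
    coversProbes26 gaugeFix_fcc

/-- **`RegaugeAt` at hcp, UNCONDITIONAL** (same currency and constants). -/
theorem regaugeAt_lsGauge_hcp (θ : ℝ) (P : ℝ × ℝ × ℝ × ℝ) :
    RegaugeAt hcpKissingPattern probes26 (lsGauge hcpKissingPattern) θ P
      ((1 + 2 * Real.sqrt 3) * (11281 / 10000 * P.1),
        11281 / 10000 * P.2.1 + Real.sqrt 2 * (2 * Real.sqrt 3 * (11281 / 10000 * P.1)),
        11281 / 10000 * P.2.2.1 + 2 * Real.sqrt 3 * (11281 / 10000 * P.1),
        11281 / 10000 * P.2.2.2 + 2 * Real.sqrt 3 * (11281 / 10000 * P.1)) :=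
  regaugeAt_of_gaugeFix (fun _ hz => norm_eq_one_of_mem_hcpKissingPattern hz) norm_le_one_of_mem_probes26 (by norm_num)
    coversProbes26 gaugeFix_hcp

/-- ★★ **`AperiodicFrustratedLawGap` (crux of item 27623) BY NAME with the re-gauging hypotheses DISCHARGED**: from `Door ∧ Price(1/100) ∧ G ∧ P`,
per pattern an UNGAUGED 26-probe entry `P₀ = (a, aq, b, bq)` [CERT], a `GLadderCert26At` chain [CERT, LP tables] starting at the re-gauged tuple
`((1+2√3)ρa, ρ·aq + 2√6ρa, ρb + 2√3ρa, ρ·bq + 2√3ρa)` (`ρ = 1.1281`), and the terminal arithmetic `1.1281·Q.1 < 1/20`.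
Compared with `aperiodicFrustratedLawGap_of_gaugedLadders26` the two `RegaugeAt` hypotheses are gone. [folklore chaining] -/
theorem aperiodicFrustratedLawGap_of_gaugedLadders26_lsGauge {Pf₀ Qf Ph₀ Qh : ℝ × ℝ × ℝ × ℝ} {Lf Lh : List (ℝ × ℝ × ℝ × ℝ)}
    (hDoor : Summit.AtomisticToContinuum.Crystallization.Theses.GrainCoreNetworkSplit.MuEquilibriumDoor) (hprice : PriceTol (1 / 100))
    (hG : LinkClassification (1 / 100)) (hP : CapForcing (1 / 100))
    (hUf : GEntryAt fccKissingPattern probes26 (noGauge _) (1 / 100) Pf₀)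
    (hCf : GLadderCert26At fccKissingPattern
      ((1 + 2 * Real.sqrt 3) * (11281 / 10000 * Pf₀.1),
        11281 / 10000 * Pf₀.2.1 + Real.sqrt 2 * (2 * Real.sqrt 3 * (11281 / 10000 * Pf₀.1)),
        11281 / 10000 * Pf₀.2.2.1 + 2 * Real.sqrt 3 * (11281 / 10000 * Pf₀.1),
        11281 / 10000 * Pf₀.2.2.2 + 2 * Real.sqrt 3 * (11281 / 10000 * Pf₀.1)) Lf Qf)
    (hQf : 11281 / 10000 * Qf.1 < 1 / 20)
    (hUh : GEntryAt hcpKissingPattern probes26 (noGauge _) (1 / 100) Ph₀)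
    (hCh : GLadderCert26At hcpKissingPattern
      ((1 + 2 * Real.sqrt 3) * (11281 / 10000 * Ph₀.1),
        11281 / 10000 * Ph₀.2.1 + Real.sqrt 2 * (2 * Real.sqrt 3 * (11281 / 10000 * Ph₀.1)),
        11281 / 10000 * Ph₀.2.2.1 + 2 * Real.sqrt 3 * (11281 / 10000 * Ph₀.1),
        11281 / 10000 * Ph₀.2.2.2 + 2 * Real.sqrt 3 * (11281 / 10000 * Ph₀.1)) Lh Qh)
    (hQh : 11281 / 10000 * Qh.1 < 1 / 20) :
    Summit.AtomisticToContinuum.Crystallization.Theses.FrustratedLawDichotomy.AperiodicFrustratedLawGap :=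
  aperiodicFrustratedLawGap_of_gaugedLadders26 hDoor hprice hG hP hUf (regaugeAt_lsGauge_fcc _ _) hCf hQf hUh
    (regaugeAt_lsGauge_hcp _ _) hCh hQh

end Summit.AtomisticToContinuum.Crystallization.Theorems.FrustratedLawDichotomyTwoShellRigidityGaugeFix
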